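import Mathlib
import HarnessLib
import Summits.Ventures.LatticeQCDFlow.Exactness.SphereGradientFlow
import Summits.Ventures.LatticeQCDFlow.Exactness.SphereLatticeLuscherKernel

/-!
# The rung's site map is a consistent one-step integrator of the exact leading-order flow: `Φ_ε(x)_n − geodesicKick(ε κ/(d−1), J_n x, x_n) = o(ε)` on the lattice of site spheres

HONEST FRAMING: exact (Metropolis-corrected) sampling algorithms for lattice gauge theory;
figures of merit are autocorrelation/cost numbers at stated couplings and volumes; no
continuum-physics claim.

Venture `LatticeQCDFlow` (cell pub-lqcd), topic `Exactness`; FANOUT row 7 (`s0-cpn-null`: the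
S0-D1 rung — Lüscher's LO trivializing map for 2D CP⁹ integrated by geodesic Euler steps inside
HMC, Engel–Schaefer 2011).  NEW WORK of the cell over the tree's `Exactness/SphereGradientFlow.lean`
(this leg: the exact flow `Φ_t = sphereGradientFlow hG · t` of `ẋ_n = −∂̃_nG(x)` on `Ω̃`,
`hasDerivAt_sphereGradientFlow`), `Exactness/SphereLOFlowAction.lean` (E–S eq. (17):
`eulerStep ε T x = cos(ε‖T‖)x + (sin(ε‖T‖)/‖T‖)T`; `eulerStep_loGenerator`: the Euler step of
`ẋ_n = T_n` IS the rung's site map `geodesicKick (εκ/(d−1)) (J_n x) (x n)`; `loGenerator = −∂̃S̃⁽⁰⁾`)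
and `Exactness/SphereLatticeLuscherKernel.lean` (`contDiff_loFlowAction`); the tree's
`Exactness/SphereLOFlowFirstOrder.lean` (GEN-5) has the velocity of the kick and the first-order
change of the effective action along the SIMULTANEOUS Euler step — this file compares the step with
the EXACT flow, which did not exist in the tree before `SphereGradientFlow`; nothing is cited as a
fact.  Printed counterpart, NAMED ONLY: Engel–Schaefer, Comput. Phys. Commun. 182 (2011) 2107, §3
eqs. (14)–(17) ("we integrate the flow equation with the simple Euler scheme … `x_n(t+ε_s) =
cos α_n x_n + sin α_n T_n/|T_n|`").

## Content

* §1 **`hasDerivAt_eulerStep_zero`** — the geodesic Euler step `ε ↦ eulerStep ε T x` passes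
  through `x` at `ε = 0` with velocity `T` (also for `T = 0`, where it is constant); the tree's
  `SphereLOFlowFirstOrder.hasDerivAt_geodesicKick_zero` (GEN-5) is the same fact for
  `ε ↦ geodesicKick (εa) J u`.
* §2 **`sphereGradientFlow_sub_eulerStep_isLittleO`** — FIRST-ORDER CONSISTENCY: for `G ∈ C²`,
  `x ∈ Ω̃` and every site `n`, `Φ_ε(x)_n − eulerStep ε (−∂̃_nG(x)) (x_n) = o(ε)` as `ε → 0` (both
  curves leave `x_n` with velocity `−∂̃_nG(x)`).
* §3 **`loFlow_sub_geodesicKick_isLittleO`** — THE RUNG'S SITE MAP: with `G = S̃⁽⁰⁾ =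
  loFlowAction κ S₀ U` (no self-coupling, adjoint pairs, `κ ≥ 0`, `d ≥ 2`),
  `Φ_ε(x)_n − geodesicKick (ε·κ/(d−1)) (J_n x) (x_n) = o(ε)`: each site update of the
  Engel–Schaefer sweep (neighbours frozen) is consistent to first order with the exact
  leading-order trivializing flow constructed in `SphereGradientFlow`.

NOT CLAIMED: the second-order local error `O(ε²)` (true, needs the `C²` regularity of flow lines
in time — not typed), global error / stability of the sweep, anything about the composition of
site updates (the sweep is sequential with frozen neighbours; here one site, one step), step-size
choices or the rung's numbers.
-/

noncomputable section

namespace Summit.Ventures.LatticeQCDFlow.Exactness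

open Function Set Metric NormedSpace InnerProductSpace Asymptotics Filter
open scoped RealInnerProductSpace Topology

variable {E : Type*} [NormedAddCommGroup E] [InnerProductSpace ℝ E]

/-! ## §1 The geodesic Euler step leaves `x` with velocity `T` -/

section Step

/-- **`(d/dε) eulerStep ε T x |_{ε=0} = T`**: the step `cos(ε‖T‖)x + (sin(ε‖T‖)/‖T‖)T` passes
through `x` with velocity `T` (for `T = 0` it is the constant `x` and the claim is `0 = 0`). -/
theorem hasDerivAt_eulerStep_zero (T x : E) : HasDerivAt (fun ε : ℝ => eulerStep ε T x) T 0 := by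
  unfold eulerStep
  have hc : HasDerivAt (fun ε : ℝ => Real.cos (ε * ‖T‖)) (-Real.sin (0 * ‖T‖) * (1 * ‖T‖)) 0 :=
    ((hasDerivAt_id (0 : ℝ)).mul_const ‖T‖).cos
  have hs : HasDerivAt (fun ε : ℝ => Real.sin (ε * ‖T‖) / ‖T‖)
      (Real.cos (0 * ‖T‖) * (1 * ‖T‖) / ‖T‖) 0 :=
    ((hasDerivAt_id (0 : ℝ)).mul_const ‖T‖).sin.div_const ‖T‖
  have h := (hc.smul_const x).add (hs.smul_const T)
  simp only [zero_mul, Real.sin_zero, neg_zero, one_mul, Real.cos_zero, zero_smul, zero_add] at h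
  by_cases hT : T = 0
  · simp only [hT, norm_zero, div_zero, smul_zero] at h ⊢
    exact h
  · rwa [div_self (norm_ne_zero_iff.2 hT), one_smul] at h

end Step

/-! ## §2 First-order consistency with the exact flow -/

section Consistency

variable {Λ : Type*} [Fintype Λ] [DecidableEq Λ] [FiniteDimensional ℝ E] {G : (Λ → E) → ℝ}

/-- **`Φ_ε(x)_n − eulerStep ε (−∂̃_nG(x)) (x_n) = o(ε)`** for `x ∈ Ω̃`: the exact gradient flow and
the geodesic Euler step with the generator frozen at `x` agree to first order at every site. -/
theorem sphereGradientFlow_sub_eulerStep_isLittleO (hG : ContDiff ℝ 2 G) {x : Λ → E}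
    (hx : ∀ n, ‖x n‖ = 1) (n : Λ) :
    (fun ε : ℝ => sphereGradientFlow hG x ε n - eulerStep ε (-siteGrad n G x) (x n)) =o[𝓝 0]
      fun ε => ε := by
  have h1 : HasDerivAt (fun ε : ℝ => sphereGradientFlow hG x ε n) (-siteGrad n G x) 0 := by
    have h := (hasDerivAt_pi.1 (hasDerivAt_sphereGradientFlow hG hx 0)) n
    simpa only [sphereGradientFlow_zero] using h
  have h2 := hasDerivAt_eulerStep_zero (-siteGrad n G x) (x n)
  have h := (h1.sub h2)
  rw [sub_self, hasDerivAt_iff_isLittleO] at h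
  simpa [sphereGradientFlow_zero, eulerStep] using h

end Consistency

/-! ## §3 The rung's site map and the exact leading-order flow -/

section Rung

variable {Λ : Type*} [Fintype Λ] [DecidableEq Λ] [FiniteDimensional ℝ E]
  {U : Λ → Λ → (E →L[ℝ] E)}

/-- **THE RUNG'S SITE MAP IS FIRST-ORDER CONSISTENT WITH THE EXACT LO TRIVIALIZING FLOW**: for the
E–S action (no self-coupling, adjoint pairs, `κ ≥ 0`, `d ≥ 2`) and `x ∈ Ω̃`,
`Φ_ε(x)_n − geodesicKick (ε·κ/(d−1)) (J_n x) (x_n) = o(ε)`, where `Φ` is the flow of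
`S̃⁽⁰⁾ = S/(2(d−1))` (`ẋ_n = T_n`) and `geodesicKick` the single-site update of the sweep. -/
theorem loFlow_sub_geodesicKick_isLittleO (hU0 : ∀ n, U n n = 0)
    (hUadj : ∀ m n (v w : E), ⟪U m n v, w⟫ = ⟪v, U n m w⟫) (hd : 2 ≤ Module.finrank ℝ E)
    {κ : ℝ} (hκ : 0 ≤ κ) (S₀ : ℝ) {x : Λ → E} (hx : ∀ n, ‖x n‖ = 1) (n : Λ) :
    (fun ε : ℝ => sphereGradientFlow (contDiff_loFlowAction U κ S₀) x ε n -
        geodesicKick (ε * (κ / ((Module.finrank ℝ E : ℝ) - 1))) (localField U n x) (x n)) =o[𝓝 0]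
      fun ε => ε := by
  have h := sphereGradientFlow_sub_eulerStep_isLittleO (contDiff_loFlowAction U κ S₀ (m := 2)) hx n
  refine h.congr' (Eventually.of_forall fun ε => ?_) EventuallyEq.rfl
  dsimp only
  rw [← eulerStep_loGenerator hU0 hUadj hd hκ S₀ ε (hx n), loGenerator]

end Rung

end Summit.Ventures.LatticeQCDFlow.Exactness

end
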